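import Summits.ABC.IUTFork.Repair.RHHullThresholdExact
import HarnessLib

/-!
# HEX `k = 8` and `k = 11`: the top-label hull cell at `p = 7` FAILS on `11 ≤ l ≤ 71` (`k = 8`, the sharp class forces `A = 15`) and on
# `481 ≤ l ≤ 811` (`k = 11`, BOTH members `A ∈ {15, 30}` of the sharp class) — the integer side of the M-line REF twins of abc-iut-rh-typ-4's
# K-line hull-threshold bands (row «W:REF-EXACT-M-TWIN», HEX part, axes `k = 8, 11`)

PROOF-ONLY file (D-0012; 0 definitions, 0 `Prop` facts, no instance) of the abc-iut cell — D-0079 RESCUE sub-cell R-W «WINDOW Θ-SIDE INEQUALITY», seat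
abc-iut-W-neg-1 (gen 6). PURE ARITHMETIC in the byte shape of this seat's `HexRefutedMidCells` (p530534) / abc-iut-C-cert-1's `RefBand.cells_hex<k>_band`.
On the K line these two ranges are abc-iut-rh-typ-4's pinned-type hull-cell theorems (`HexHullThresholdGenuineRows` p473785, `l ≤ 71`, every `k`;
`HexHullThreshold.not_pilotKummerCompatHull_lamSeven_eleven_band`, `481 … 811`), the REFUTED sides of record of the axes `k = 8` (`L₀ = 71`, INHABITED from `73`:
abc-iut-w5-d107 `WRow.licence_lamSeven_eight_all`) and `k = 11` (`L₀ = 811`, INHABITED from `821`: `WRow.licence_lamSeven_eleven_all`), which have no M twin; the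
M-line hull-cell engine (this seat's `GenuineM.not_pilotKummerCompatHull_triple_of_hullCells_tameSharp`, p528325) is CLASS-ROBUST and needs the failing cell at EVERY
member of the sharp class: `k = 8` (`v = 8` even): `A = 15` only; `k = 11` (`v = 11`): `A ∈ {15, 30}` — and the cell fails at both up to `811` (desk, exact integers,
every odd `l`: `A = 30` first holds at `821`, `A = 15` at `1663`). Lemmas: `RefBand.not_hullCell_hex8low_A15_a2` / `…_a3`, **`RefBand.cells_hex8_low`** (`11 ≤ l ≤ 71`);
`RefBand.not_hullCell_hex11mid_A15_a4`, `RefBand.not_hullCell_hex11mid_A30_a5`, **`RefBand.cells_hex11_mid`** (`481 ≤ l ≤ 811`). HONEST SCOPE: integer inequalities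
only; nothing about any datum, (P6), admissibility or [IUTchIII] Cor. 3.12; no side taken; no abc claim. [cite: Mochizuki2012, IUTchIV Prop. 1.1 p. 9, Prop. 1.2 (i)(ii) p. 10]
[cite: DupuyHilado2025, §4.9] [claim: Mochizuki2012, status: disputed]
-/

noncomputable section

namespace Summit.ABC.IUTFork.Conditional

open Summit.ABC.IUTFork.Repair.RH.HullThresholdExact

/-! ## HEX `k = 8`: class `A ∈ {15}`, `11 ≤ l ≤ 71` -/

/-- Floor-free failure of the top-label cell, `k = 8`, member `A = 15` (`e = 15l`, `m = 120`), turning point `a₀ = 2` (`r_out = 49 − 2·15l`),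
every `5 ≤ j ≤ 9` (`l = 2j + 1`), ANY inner radius with `6·r_in ≤ 15l + 6`: downward parabola in `j`, positive on the range. [folklore] -/
theorem RefBand.not_hullCell_hex8low_A15_a2 {j rin : ℤ} (hlo : 5 ≤ j) (hhi : j ≤ 9) (hrin : 6 * rin ≤ 15 * (2 * j + 1) + 6) :
    ¬ HullCell (15 * (2 * j + 1)) 120 j rin (49 - 2 * (15 * (2 * j + 1))) := by
  intro hc
  unfold HullCell at hc
  set e : ℤ := 15 * (2 * j + 1) with he
  have he0 : 0 < e := by rw [he]; omega
  set X : ℤ := j ^ 2 * 120 - j * (e - 1) - (j + 1) * rin with hX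
  have hdiv : X - e < e * (X / e) := by
    have h1 := Int.emod_add_mul_ediv X e
    have h2 := Int.emod_lt_of_pos X he0
    have h3 := Int.emod_nonneg X he0.ne'
    nlinarith [h1, h2, h3]
  have hk1 : 0 ≤ (9 - j) * (j + 1) := mul_nonneg (by omega) (by omega)
  have hk2 : 0 ≤ (9 - j) * (j - 5) := mul_nonneg (by omega) (by omega)
  nlinarith [hdiv, hk1, hk2, hc, hrin, hX]

/-- Floor-free failure of the top-label cell, `k = 8`, member `A = 15` (`e = 15l`, `m = 120`), turning point `a₀ = 3` (`r_out = 343 − 3·15l`),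
every `10 ≤ j ≤ 32` (`l = 2j + 1`), ANY inner radius with `6·r_in ≤ 15l + 6`: downward parabola in `j`, positive on the range. [folklore] -/
theorem RefBand.not_hullCell_hex8low_A15_a3 {j rin : ℤ} (hlo : 10 ≤ j) (hhi : j ≤ 32) (hrin : 6 * rin ≤ 15 * (2 * j + 1) + 6) :
    ¬ HullCell (15 * (2 * j + 1)) 120 j rin (343 - 3 * (15 * (2 * j + 1))) := by
  intro hc
  unfold HullCell at hc
  set e : ℤ := 15 * (2 * j + 1) with he
  have he0 : 0 < e := by rw [he]; omega
  set X : ℤ := j ^ 2 * 120 - j * (e - 1) - (j + 1) * rin with hX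
  have hdiv : X - e < e * (X / e) := by
    have h1 := Int.emod_add_mul_ediv X e
    have h2 := Int.emod_lt_of_pos X he0
    have h3 := Int.emod_nonneg X he0.ne'
    nlinarith [h1, h2, h3]
  have hk1 : 0 ≤ (32 - j) * (j + 1) := mul_nonneg (by omega) (by omega)
  have hk2 : 0 ≤ (32 - j) * (j - 10) := mul_nonneg (by omega) (by omega)
  nlinarith [hdiv, hk1, hk2, hc, hrin, hX]

/-- **HEX `k = 8`, low range: the hull-cell engine's `hcell` at `p = 7` (`v = 8`), odd `11 ≤ l ≤ 71`, top label; the sharp class is `A ∈ {15}` and the cell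
fails at every member.** [folklore] -/
theorem RefBand.cells_hex8_low {l : ℕ} (hlo : 11 ≤ l) (hhi : l ≤ 71) (hodd : Odd l) {i : ℕ} (hi : i + 1 = (l - 1) / 2)
    (A : ℕ) (hA30 : A ∣ 30) (hA15 : 15 ∣ A * 8) (hAev : Even 8 → A ∣ 15) (hA3 : 3 ∣ 8 → A ∣ 10) (hA5 : 5 ∣ 8 → A ∣ 6) :
    ∃ a₀ : ℕ, (∀ s : ℕ, s < a₀ → (1 : ℤ) * ((7 : ℕ) : ℤ) ^ s * (((7 : ℕ) : ℤ) - 1) < ((A * l : ℕ) : ℤ)) ∧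
      ((A * l : ℕ) : ℤ) ≤ 1 * ((7 : ℕ) : ℤ) ^ a₀ * (((7 : ℕ) : ℤ) - 1) ∧
      ¬ HullCell ((A * l : ℕ) : ℤ) ((A * 8 : ℕ) : ℤ) ((i : ℤ) + 1) (((A * l) / ((7 : ℕ) - 1) + 1 : ℕ) : ℤ)
        (((7 : ℕ) : ℤ) ^ a₀ - (a₀ : ℤ) * ((A * l : ℕ) : ℤ)) := by
  have hA31 : A ≤ 30 := Nat.le_of_dvd (by norm_num) hA30
  have hcl1 : A ∣ 15 := hAev (by decide)
  obtain ⟨j, hj⟩ := hodd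
  have hij : (i : ℤ) + 1 = (j : ℤ) := by
    have : i + 1 = j := by omega
    exact_mod_cast this
  have hA : A = 15 := by
    interval_cases A <;> first | rfl | (exfalso; revert hA30 hA15 hcl1; decide)
  rcases hA with rfl
  by_cases hx : 67 ≤ l
  · have hl3 : l = 67 ∨ l = 69 ∨ l = 71 := by omega
    rcases hl3 with rfl | rfl | rfl
    · obtain rfl : i = 32 := by omega
      refine ⟨3, fun s hs => ?_, by norm_num, ?_⟩
      · interval_cases s <;> norm_num
      · unfold HullCell; norm_num
    · obtain rfl : i = 33 := by omega
      refine ⟨3, fun s hs => ?_, by norm_num, ?_⟩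
      · interval_cases s <;> norm_num
      · unfold HullCell; norm_num
    · obtain rfl : i = 34 := by omega
      refine ⟨3, fun s hs => ?_, by norm_num, ?_⟩
      · interval_cases s <;> norm_num
      · unfold HullCell; norm_num
  · have hrin : (6 : ℤ) * (((((15 * l) / ((7 : ℕ) - 1) + 1 : ℕ) : ℤ))) ≤ 15 * (2 * (j : ℤ) + 1) + 6 := by
      have h0 : ((7 : ℕ) - 1) * ((15 * l) / ((7 : ℕ) - 1)) ≤ 15 * l := Nat.mul_div_le _ _
      have h1 : (6 : ℤ) * ((((15 * l) / ((7 : ℕ) - 1) : ℕ) : ℤ)) ≤ ((15 * l : ℕ) : ℤ) := by exact_mod_cast h0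
      push_cast at h1 ⊢; omega
    have he : ((15 * l : ℕ) : ℤ) = 15 * (2 * (j : ℤ) + 1) := by push_cast; omega
    have hm : ((15 * 8 : ℕ) : ℤ) = 120 := by norm_num
    by_cases hp0 : 11 ≤ l ∧ l ≤ 19
    · refine ⟨2, fun s hs => ?_, ?_, ?_⟩
      · interval_cases s <;> norm_num <;> omega
      · norm_num; omega
      · have hro : (((7 : ℕ) : ℤ) ^ 2 - ((2 : ℕ) : ℤ) * ((15 * l : ℕ) : ℤ)) = 49 - 2 * (15 * (2 * (j : ℤ) + 1)) := by
          push_cast; omega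
        rw [hro, hij, he, hm]
        exact RefBand.not_hullCell_hex8low_A15_a2 (by omega) (by omega) hrin
    by_cases hp1 : 21 ≤ l ∧ l ≤ 65
    · refine ⟨3, fun s hs => ?_, ?_, ?_⟩
      · interval_cases s <;> norm_num <;> omega
      · norm_num; omega
      · have hro : (((7 : ℕ) : ℤ) ^ 3 - ((3 : ℕ) : ℤ) * ((15 * l : ℕ) : ℤ)) = 343 - 3 * (15 * (2 * (j : ℤ) + 1)) := by
          push_cast; omega
        rw [hro, hij, he, hm]
        exact RefBand.not_hullCell_hex8low_A15_a3 (by omega) (by omega) hrin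
    exfalso; omega

/-! ## HEX `k = 11`: class `A ∈ {15, 30}`, `481 ≤ l ≤ 811` -/

/-- Floor-free failure of the top-label cell, `k = 11`, member `A = 15` (`e = 15l`, `m = 165`), turning point `a₀ = 4` (`r_out = 2401 − 4·15l`),
every `240 ≤ j ≤ 405` (`l = 2j + 1`), ANY inner radius with `6·r_in ≤ 15l + 6`: downward parabola in `j`, positive on the range. [folklore] -/
theorem RefBand.not_hullCell_hex11mid_A15_a4 {j rin : ℤ} (hlo : 240 ≤ j) (hhi : j ≤ 405) (hrin : 6 * rin ≤ 15 * (2 * j + 1) + 6) :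
    ¬ HullCell (15 * (2 * j + 1)) 165 j rin (2401 - 4 * (15 * (2 * j + 1))) := by
  intro hc
  unfold HullCell at hc
  set e : ℤ := 15 * (2 * j + 1) with he
  have he0 : 0 < e := by rw [he]; omega
  set X : ℤ := j ^ 2 * 165 - j * (e - 1) - (j + 1) * rin with hX
  have hdiv : X - e < e * (X / e) := by
    have h1 := Int.emod_add_mul_ediv X e
    have h2 := Int.emod_lt_of_pos X he0
    have h3 := Int.emod_nonneg X he0.ne'
    nlinarith [h1, h2, h3]
  have hk1 : 0 ≤ (405 - j) * (j + 1) := mul_nonneg (by omega) (by omega)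
  have hk2 : 0 ≤ (405 - j) * (j - 240) := mul_nonneg (by omega) (by omega)
  nlinarith [hdiv, hk1, hk2, hc, hrin, hX]

/-- Floor-free failure of the top-label cell, `k = 11`, member `A = 30` (`e = 30l`, `m = 330`), turning point `a₀ = 5` (`r_out = 16807 − 5·30l`),
every `240 ≤ j ≤ 405` (`l = 2j + 1`), ANY inner radius with `6·r_in ≤ 30l + 6`: downward parabola in `j`, positive on the range. [folklore] -/
theorem RefBand.not_hullCell_hex11mid_A30_a5 {j rin : ℤ} (hlo : 240 ≤ j) (hhi : j ≤ 405) (hrin : 6 * rin ≤ 30 * (2 * j + 1) + 6) :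
    ¬ HullCell (30 * (2 * j + 1)) 330 j rin (16807 - 5 * (30 * (2 * j + 1))) := by
  intro hc
  unfold HullCell at hc
  set e : ℤ := 30 * (2 * j + 1) with he
  have he0 : 0 < e := by rw [he]; omega
  set X : ℤ := j ^ 2 * 330 - j * (e - 1) - (j + 1) * rin with hX
  have hdiv : X - e < e * (X / e) := by
    have h1 := Int.emod_add_mul_ediv X e
    have h2 := Int.emod_lt_of_pos X he0
    have h3 := Int.emod_nonneg X he0.ne'
    nlinarith [h1, h2, h3]
  have hk1 : 0 ≤ (405 - j) * (j + 1) := mul_nonneg (by omega) (by omega)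
  have hk2 : 0 ≤ (405 - j) * (j - 240) := mul_nonneg (by omega) (by omega)
  nlinarith [hdiv, hk1, hk2, hc, hrin, hX]

/-- **HEX `k = 11`, middle range: the hull-cell engine's `hcell` at `p = 7` (`v = 11`), odd `481 ≤ l ≤ 811`, top label; the sharp class is `A ∈ {15, 30}` and the cell
fails at every member.** [folklore] -/
theorem RefBand.cells_hex11_mid {l : ℕ} (hlo : 481 ≤ l) (hhi : l ≤ 811) (hodd : Odd l) {i : ℕ} (hi : i + 1 = (l - 1) / 2)
    (A : ℕ) (hA30 : A ∣ 30) (hA15 : 15 ∣ A * 11) (hAev : Even 11 → A ∣ 15) (hA3 : 3 ∣ 11 → A ∣ 10) (hA5 : 5 ∣ 11 → A ∣ 6) :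
    ∃ a₀ : ℕ, (∀ s : ℕ, s < a₀ → (1 : ℤ) * ((7 : ℕ) : ℤ) ^ s * (((7 : ℕ) : ℤ) - 1) < ((A * l : ℕ) : ℤ)) ∧
      ((A * l : ℕ) : ℤ) ≤ 1 * ((7 : ℕ) : ℤ) ^ a₀ * (((7 : ℕ) : ℤ) - 1) ∧
      ¬ HullCell ((A * l : ℕ) : ℤ) ((A * 11 : ℕ) : ℤ) ((i : ℤ) + 1) (((A * l) / ((7 : ℕ) - 1) + 1 : ℕ) : ℤ)
        (((7 : ℕ) : ℤ) ^ a₀ - (a₀ : ℤ) * ((A * l : ℕ) : ℤ)) := by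
  have hA31 : A ≤ 30 := Nat.le_of_dvd (by norm_num) hA30
  obtain ⟨j, hj⟩ := hodd
  have hij : (i : ℤ) + 1 = (j : ℤ) := by
    have : i + 1 = j := by omega
    exact_mod_cast this
  have hA : A = 15 ∨ A = 30 := by
    interval_cases A <;> first | (left; rfl) | (right; rfl) | (exfalso; revert hA30 hA15; decide)
  rcases hA with rfl | rfl
  · have hrin : (6 : ℤ) * (((((15 * l) / ((7 : ℕ) - 1) + 1 : ℕ) : ℤ))) ≤ 15 * (2 * (j : ℤ) + 1) + 6 := by
      have h0 : ((7 : ℕ) - 1) * ((15 * l) / ((7 : ℕ) - 1)) ≤ 15 * l := Nat.mul_div_le _ _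
      have h1 : (6 : ℤ) * ((((15 * l) / ((7 : ℕ) - 1) : ℕ) : ℤ)) ≤ ((15 * l : ℕ) : ℤ) := by exact_mod_cast h0
      push_cast at h1 ⊢; omega
    have he : ((15 * l : ℕ) : ℤ) = 15 * (2 * (j : ℤ) + 1) := by push_cast; omega
    have hm : ((15 * 11 : ℕ) : ℤ) = 165 := by norm_num
    refine ⟨4, fun s hs => ?_, ?_, ?_⟩
    · interval_cases s <;> norm_num <;> omega
    · norm_num; omega
    · have hro : (((7 : ℕ) : ℤ) ^ 4 - ((4 : ℕ) : ℤ) * ((15 * l : ℕ) : ℤ)) = 2401 - 4 * (15 * (2 * (j : ℤ) + 1)) := by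
        push_cast; omega
      rw [hro, hij, he, hm]
      exact RefBand.not_hullCell_hex11mid_A15_a4 (by omega) (by omega) hrin
  · have hrin : (6 : ℤ) * (((((30 * l) / ((7 : ℕ) - 1) + 1 : ℕ) : ℤ))) ≤ 30 * (2 * (j : ℤ) + 1) + 6 := by
      have h0 : ((7 : ℕ) - 1) * ((30 * l) / ((7 : ℕ) - 1)) ≤ 30 * l := Nat.mul_div_le _ _
      have h1 : (6 : ℤ) * ((((30 * l) / ((7 : ℕ) - 1) : ℕ) : ℤ)) ≤ ((30 * l : ℕ) : ℤ) := by exact_mod_cast h0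
      push_cast at h1 ⊢; omega
    have he : ((30 * l : ℕ) : ℤ) = 30 * (2 * (j : ℤ) + 1) := by push_cast; omega
    have hm : ((30 * 11 : ℕ) : ℤ) = 330 := by norm_num
    refine ⟨5, fun s hs => ?_, ?_, ?_⟩
    · interval_cases s <;> norm_num <;> omega
    · norm_num; omega
    · have hro : (((7 : ℕ) : ℤ) ^ 5 - ((5 : ℕ) : ℤ) * ((30 * l : ℕ) : ℤ)) = 16807 - 5 * (30 * (2 * (j : ℤ) + 1)) := by
        push_cast; omega
      rw [hro, hij, he, hm]
      exact RefBand.not_hullCell_hex11mid_A30_a5 (by omega) (by omega) hrin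

end Summit.ABC.IUTFork.Conditional

end
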